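import Summits.CriticalPhenomena.PercolationContinuityZ3.Theorems.PercNearOneGluingNoHeavyLowerTailKnQuestion8CoefficientwiseAttachmentFlipWeak
import Summits.CriticalPhenomena.PercolationContinuityZ3.Theorems.PercNearOneGluingNoHeavyLowerTailDualBHKBlock
import Summits.CriticalPhenomena.PercolationContinuityZ3.Theorems.PercNearOneGluingNoHeavyLowerTailKnQuestion8CoefficientwiseGluing
import HarnessLib

/-!
# Islands: a region around the root sealed by doubly-reachable vertices factorises the point row (prim-lf-2 gen 36, ISLAND FACTORISATION §2)

Support file (`--supports stmt-CriticalPhenomena-4575`, closed), prover `prim-lf-2` (gen 36).  No definitions, no named facts, no sorries; standard axioms.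
Memo `prim-lf-2/CW-RESIDUE-gen36.md` §2 (Lemma A and the fixed-island factorisation; the maximal-island / PRIME version is pencil + census there).

Setting: finite multigraph `ends : ι → Sym2 V`, edge set `E`, root `x`, colouring `c ⊆ E` (one colour), `C(c) = openCluster
      (ends '' c) x`.  For a vertex set `Y ∋ x`
let `E_Y = {i ∈ E | both ends in Y}` and call `t ∈ Y \ {x}` a BOUNDARY vertex of `Y` if some `E`-edge joins it to a vertex outside `Y`.  `Y` is a (one-colour)
ISLAND for `c` if every boundary vertex lies in `C(c ∩ E_Y)` (reachable from the root INSIDE `Y`).  Then (Lemma A of the memo):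
* `Coefficientwise.mem_openCluster_iff_inter_of_island` — for `v ∈ Y`:  `v ∈ C(c) ↔ v ∈ C(c ∩ E_Y)`  (what happens in `Y` is decided inside `Y`);
* `Coefficientwise.mem_openCluster_iff_union_of_island` — for `v ∉ Y`:  `v ∈ C(c)
      ↔ v ∈ C(c ∪ E_Y)`  (seen from outside, the island is one big root: all its
  internal edges may be declared open);
both by the closed-set principle (`openCluster_subset_of_closed`).  Consequence for the two-colouring point row with a wall SET `Z` and points `u, w ∉ Y`:
* `Coefficientwise.pointRow_sum_island_factor` — **fixed-island factorisation**: the point-row sum restricted to the wall colourings `s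
      ⊆ E` for which `Y` is a
  (two-colour) island equals  `N_isl(Y) · P_Y`, where `N_isl(Y)` = the number of colourings `s₀
        ⊆ E_Y` making `Y` an island with the wall vertices inside `Y`
  off the zone, and `P_Y` = the point-row sum of the 'quotient' — colourings `s₁
        ⊆ E \ E_Y`, clusters computed with all of `E_Y` added to both colours, wall
  vertices outside `Y`.  (Memo §2: summing the analogous identity over the MAXIMAL island `Y_max(s)` gives `P(G) = Σ_Y N_isl(Y)·R(G/Y)` with `R`
        = the point-row
  sum over PRIME colourings of the quotient; CONJECTURE PRIME POSITIVITY `R ≥ 0` ⟹ the point row.  The maximal version needs the island correspondence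
  Lemma B and is not in this file.)
[cite: KozmaNitzan2024, Questions 8–9 (§5.5 p. 36) (context: the Question-8 pocket covariance programme)]
-/

namespace Summit.CriticalPhenomena.PercolationContinuityZ3.Theorems

open Finset Literature.Probability.Percolation

namespace Coefficientwise

variable {ι V : Type*}

open Classical in
/-- The cluster of the root computed with edges inside `Y` only stays inside `Y` (`x ∈ Y`). [cite: KozmaNitzan2024, §5.5 (context only; folklore)] -/
theorem openCluster_filter_inside_subset (ends : ι → Sym2 V) (c : Finset ι) (x : V) (Y : Set V) (hxY : x ∈ Y) :
    openCluster (ends '' (↑(c.filter (fun i => ∀ y ∈ ends i, y ∈ Y)) : Set ι)) x ⊆ Y := by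
  refine openCluster_subset_of_closed ends _ x hxY ?_
  intro i hi a b he _
  rw [Finset.mem_filter] at hi
  exact hi.2 b (by rw [he]; exact Sym2.mem_mk_right a b)

open Classical in
/-- **Lemma A (inside).**  If every boundary vertex of `Y ∋ x` is reachable from `x` by `c`-edges inside `Y`, then for `v ∈ Y`:
`v ∈ C(c) ↔ v ∈ C(c ∩ E_Y)`. [cite: KozmaNitzan2024, §5.5 (context only; folklore)] -/
theorem mem_openCluster_iff_inter_of_island (ends : ι → Sym2 V) (E c : Finset ι) (hc : c ⊆ E) (x : V) (Y : Set V) (hxY : x ∈ Y)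
    (hIsl : ∀ t ∈ Y, t ≠ x → (∃ i ∈ E, ∃ t', ends i = s(t, t') ∧ t' ∉ Y) →
      t ∈ openCluster (ends '' (↑(c.filter (fun i => ∀ y ∈ ends i, y ∈ Y)) : Set ι)) x)
    {v : V} (hv : v ∈ Y) :
    v ∈ openCluster (ends '' (↑c : Set ι)) x ↔ v ∈ openCluster (ends '' (↑(c.filter (fun i => ∀ y ∈ ends i, y ∈ Y)) : Set ι)) x := by
  set cY : Finset ι := c.filter (fun i => ∀ y ∈ ends i, y ∈ Y) with hcY
  constructor
  · intro hvc
    -- closed set: `C(cY) ∪ (V \ Y)`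
    have key : openCluster (ends '' (↑c : Set ι)) x ⊆ {y | y ∈ openCluster (ends '' (↑cY : Set ι)) x ∨ y ∉ Y} := by
      refine openCluster_subset_of_closed ends c x (Or.inl (mem_openCluster_self _ _)) ?_
      intro i hi a b he ha
      by_cases hbY : b ∈ Y
      · rcases ha with haC | haY
        · have haY : a ∈ Y := openCluster_filter_inside_subset ends c x Y hxY haC
          have hiY : i ∈ cY := by
            rw [hcY, Finset.mem_filter]
            refine ⟨hi, fun y hy => ?_⟩
            rw [he, Sym2.mem_iff] at hy
            rcases hy with rfl | rfl
            · exact haY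
            · exact hbY
          exact Or.inl (mem_openCluster_of_edge ends hiY he haC)
        · by_cases hbx : b = x
          · subst hbx; exact Or.inl (mem_openCluster_self _ _)
          · exact Or.inl (hIsl b hbY hbx ⟨i, hc hi, a, by rw [he, Sym2.eq_swap], haY⟩)
      · exact Or.inr hbY
    rcases key hvc with h | h
    · exact h
    · exact absurd hv h
  · intro h
    exact openCluster_image_mono ends (Finset.filter_subset _ _) x h

open Classical in
/-- **Lemma A (outside).**  If every boundary vertex of `Y ∋ x` is reachable from `x` by `c`-edges inside `Y`, then for `v ∉ Y`:
`v ∈ C(c) ↔ v ∈ C(c ∪ E_Y)` — declaring all edges inside the island open does not change the cluster outside the island.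
[cite: KozmaNitzan2024, §5.5 (context only; folklore)] -/
theorem mem_openCluster_iff_union_of_island (ends : ι → Sym2 V) (E c : Finset ι) (hc : c ⊆ E) (x : V) (Y : Set V) (hxY : x ∈ Y)
    (hIsl : ∀ t ∈ Y, t ≠ x → (∃ i ∈ E, ∃ t', ends i = s(t, t') ∧ t' ∉ Y) →
      t ∈ openCluster (ends '' (↑(c.filter (fun i => ∀ y ∈ ends i, y ∈ Y)) : Set ι)) x)
    {v : V} (hv : v ∉ Y) :
    v ∈ openCluster (ends '' (↑c : Set ι)) x ↔ v ∈ openCluster (ends '' (↑(c ∪ E.filter (fun i => ∀ y ∈ ends i, y ∈ Y)) : Set ι)) x := by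
  set cY : Finset ι := c.filter (fun i => ∀ y ∈ ends i, y ∈ Y) with hcY
  set EY : Finset ι := E.filter (fun i => ∀ y ∈ ends i, y ∈ Y) with hEY
  have hcYc : openCluster (ends '' (↑cY : Set ι)) x ⊆ openCluster (ends '' (↑c : Set ι)) x :=
    openCluster_image_mono ends (Finset.filter_subset _ _) x
  constructor
  · intro h
    exact openCluster_image_mono ends Finset.subset_union_left x h
  · intro hvc
    -- closed set: `C(c) ∪ (interior of Y)`
    have key : openCluster (ends '' (↑(c ∪ EY) : Set ι)) x ⊆
        {y | y ∈ openCluster (ends '' (↑c : Set ι)) x ∨ (y ∈ Y ∧ ¬ (∃ i ∈ E, ∃ t', ends i = s(y, t') ∧ t' ∉ Y))} := by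
      refine openCluster_subset_of_closed ends (c ∪ EY) x (Or.inl (mem_openCluster_self _ _)) ?_
      intro i hi a b he ha
      -- if `b ∈ Y` we are done in all cases
      have inY : b ∈ Y → b ∈ openCluster (ends '' (↑c : Set ι)) x ∨ (b ∈ Y ∧ ¬ (∃ i ∈ E, ∃ t', ends i = s(b, t') ∧ t' ∉ Y)) := by
        intro hbY
        by_cases hbx : b = x
        · subst hbx; exact Or.inl (mem_openCluster_self _ _)
        · by_cases hbd : ∃ i ∈ E, ∃ t', ends i = s(b, t') ∧ t' ∉ Y
          · exact Or.inl (hcYc (hIsl b hbY hbx hbd))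
          · exact Or.inr ⟨hbY, hbd⟩
      rcases Finset.mem_union.mp hi with hic | hiE
      · rcases ha with haC | ⟨haY, hna⟩
        · exact Or.inl (mem_openCluster_of_edge ends hic he haC)
        · -- `a` interior: every `E`-neighbour of `a` is in `Y`
          have hbY : b ∈ Y := by
            by_contra hbY
            exact hna ⟨i, hc hic, b, he, hbY⟩
          exact inY hbY
      · rw [hEY, Finset.mem_filter] at hiE
        exact inY (hiE.2 b (by rw [he]; exact Sym2.mem_mk_right a b))
    rcases key hvc with h | ⟨hvY, -⟩
    · exact h
    · exact absurd hvY hv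


open Classical in
/-- **Fixed-island factorisation of the point row** (memo CW-RESIDUE-gen36 §2, Lemma A ⇒ Φ(Y)
      = N_isl(Y)·P(G/Y)).  Root `x ∈ Y`, points `u, w ∉ Y`, wall set `Z`.
The sum of `σ_u σ_w` over the wall colourings `s
      ⊆ E` for which `Y` is an island (every boundary vertex of `Y` red- and blue-reachable from `x` inside `Y`)
equals (number of island colourings `s₀` of `E_Y` with the wall vertices in `Y` off the zone) × (the point-row sum over the colourings `s₁` of `E \ E_Y` with all
of `E_Y` added to both colours — the quotient `G/Y` — and the wall vertices outside `Y`). [cite: KozmaNitzan2024, Questions 8–9 (§5.5 p. 36) (context)] -/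
theorem pointRow_sum_island_factor (ends : ι → Sym2 V) (E : Finset ι) (x u w : V) (Z Y : Set V)
    (hxY : x ∈ Y) (huY : u ∉ Y) (hwY : w ∉ Y) :
    ∑ s ∈ E.powerset.filter (fun s : Finset ι =>
        (∀ z ∈ Z, z ∉ openCluster (ends '' (↑(s) : Set ι)) x ∧ z ∉ openCluster (ends '' (↑(E \ s) : Set ι)) x) ∧
        (∀ t ∈ Y, t ≠ x → (∃ i ∈ E, ∃ t', ends i = s(t, t') ∧ t' ∉ Y) →
          t ∈ openCluster (ends '' (↑(s.filter (fun i => ∀ y ∈ ends i, y ∈ Y)) : Set ι)) x ∧ t ∈ openCluster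
                (ends '' (↑((E \ s).filter (fun i => ∀ y ∈ ends i, y ∈ Y)) : Set ι)) x)),
      ((if u ∈ openCluster (ends '' (↑(s) : Set ι)) x then (1 : ℝ) else 0) - (if u ∈ openCluster (ends '' (↑(E \ s) : Set ι)) x then (1 : ℝ)
            else 0)) *
        ((if w ∈ openCluster (ends '' (↑(s) : Set ι)) x then (1 : ℝ) else 0) - (if w ∈ openCluster (ends '' (↑(E \ s) : Set ι)) x then (1 : ℝ)
              else 0))
    = (((E.filter (fun i => ∀ y ∈ ends i, y ∈ Y)).powerset.filter (fun s₀ : Finset ι =>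
          (∀ t ∈ Y, t ≠ x → (∃ i ∈ E, ∃ t', ends i = s(t, t') ∧ t' ∉ Y) →
          t ∈ openCluster (ends '' (↑(s₀) : Set ι)) x ∧ t ∈ openCluster (ends '' (↑(E.filter (fun i => ∀ y ∈ ends i, y ∈ Y) \ s₀) : Set ι)) x) ∧
          (∀ z ∈ Z, z ∈ Y → z ∉ openCluster (ends '' (↑(s₀) : Set ι)) x ∧ z ∉ openCluster
                (ends '' (↑(E.filter (fun i => ∀ y ∈ ends i, y ∈ Y) \ s₀) : Set ι)) x))).card : ℝ) *
      ∑ s₁ ∈ (E \ E.filter (fun i => ∀ y ∈ ends i, y ∈ Y)).powerset.filter (fun s₁ : Finset ι =>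
          (∀ z ∈ Z, z ∉ Y → z ∉ openCluster (ends '' (↑(s₁ ∪ E.filter (fun i => ∀ y ∈ ends i, y ∈ Y)) : Set ι)) x ∧ z ∉ openCluster
                (ends '' (↑(((E \ E.filter (fun i => ∀ y ∈ ends i, y ∈ Y)) \ s₁) ∪ E.filter (fun i => ∀ y ∈ ends i, y ∈ Y)) : Set ι)) x)),
        ((if u ∈ openCluster (ends '' (↑(s₁ ∪ E.filter (fun i => ∀ y ∈ ends i, y ∈ Y)) : Set ι)) x then (1 : ℝ) else 0) - (if u ∈ openCluster
              (ends '' (↑(((E \ E.filter (fun i => ∀ y ∈ ends i, y ∈ Y)) \ s₁) ∪ E.filter (fun i => ∀ y ∈ ends i, y ∈ Y)) : Set ι)) x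
              then (1 : ℝ) else 0)) *
          ((if w ∈ openCluster (ends '' (↑(s₁ ∪ E.filter (fun i => ∀ y ∈ ends i, y ∈ Y)) : Set ι)) x then (1 : ℝ) else 0) - (if w ∈ openCluster
                (ends '' (↑(((E \ E.filter (fun i => ∀ y ∈ ends i, y ∈ Y)) \ s₁) ∪ E.filter (fun i => ∀ y ∈ ends i, y ∈ Y)) : Set ι)) x
                then (1 : ℝ) else 0)) := by
  set EY : Finset ι := E.filter (fun i => ∀ y ∈ ends i, y ∈ Y) with hEY
  have hEYE : EY ⊆ E := Finset.filter_subset _ _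
  have hdisj : Disjoint EY (E \ EY) := Finset.disjoint_sdiff
  have memEY : ∀ {i : ι}, i ∈ EY ↔ i ∈ E ∧ ∀ y ∈ ends i, y ∈ Y := fun {i} => by rw [hEY, Finset.mem_filter]
  -- indicator forms
  rw [Finset.sum_filter, Finset.sum_filter, Finset.natCast_card_filter]
  rw [show E.powerset = (EY ∪ (E \ EY)).powerset by rw [Finset.union_sdiff_of_subset hEYE]]
  rw [DualBHK.sum_powerset_union hdisj, Finset.sum_mul_sum]
  refine Finset.sum_congr rfl fun s₀ hs₀ => Finset.sum_congr rfl fun s₁ hs₁ => ?_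
  rw [Finset.mem_powerset] at hs₀ hs₁
  have hs₁E : s₁ ⊆ E := fun i hi => (Finset.mem_sdiff.mp (hs₁ hi)).1
  have hcE : s₀ ∪ s₁ ⊆ E := Finset.union_subset (hs₀.trans hEYE) hs₁E
  -- bookkeeping
  have e1 : (s₀ ∪ s₁).filter (fun i => ∀ y ∈ ends i, y ∈ Y) = s₀ := by
    ext i
    rw [Finset.mem_filter, Finset.mem_union]
    constructor
    · rintro ⟨hi | hi, hin⟩
      · exact hi
      · exact absurd (memEY.mpr ⟨hs₁E hi, hin⟩) (Finset.mem_sdiff.mp (hs₁ hi)).2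
    · intro hi
      exact ⟨Or.inl hi, (memEY.mp (hs₀ hi)).2⟩
  have e2 : E \ (s₀ ∪ s₁) = (EY \ s₀) ∪ ((E \ EY) \ s₁) := by
    conv_lhs => rw [← Finset.union_sdiff_of_subset hEYE]
    exact union_sdiff_union_of_subset hdisj hs₀ hs₁
  have e3 : (E \ (s₀ ∪ s₁)).filter (fun i => ∀ y ∈ ends i, y ∈ Y) = EY \ s₀ := by
    rw [e2]
    ext i
    rw [Finset.mem_filter, Finset.mem_union, Finset.mem_sdiff, Finset.mem_sdiff, Finset.mem_sdiff]
    constructor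
    · rintro ⟨⟨hiY, hni⟩ | ⟨⟨hiE, hniY⟩, -⟩, hin⟩
      · exact ⟨hiY, hni⟩
      · exact absurd (memEY.mpr ⟨hiE, hin⟩) hniY
    · rintro ⟨hiY, hni⟩
      exact ⟨Or.inl ⟨hiY, hni⟩, (memEY.mp hiY).2⟩
  have e4 : (s₀ ∪ s₁) ∪ EY = s₁ ∪ EY := by
    ext i
    simp only [Finset.mem_union]
    constructor
    · rintro ((hi | hi) | hi)
      · exact Or.inr (hs₀ hi)
      · exact Or.inl hi
      · exact Or.inr hi
    · rintro (hi | hi)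
      · exact Or.inl (Or.inr hi)
      · exact Or.inr hi
  have e5 : (E \ (s₀ ∪ s₁)) ∪ EY = ((E \ EY) \ s₁) ∪ EY := by
    rw [e2]
    ext i
    simp only [Finset.mem_union, Finset.mem_sdiff]
    constructor
    · rintro ((⟨hiY, -⟩ | h) | hi)
      · exact Or.inr hiY
      · exact Or.inl h
      · exact Or.inr hi
    · rintro (h | hi)
      · exact Or.inl (Or.inr h)
      · exact Or.inr hi
  -- the island condition of `s₀ ∪ s₁` is that of `s₀`
  rw [e1, e3]
  by_cases hP : (∀ t ∈ Y, t ≠ x → (∃ i ∈ E, ∃ t', ends i = s(t, t') ∧ t' ∉ Y) →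
          t ∈ openCluster (ends '' (↑(s₀) : Set ι)) x ∧ t ∈ openCluster (ends '' (↑(E.filter (fun i => ∀ y ∈ ends i, y ∈ Y) \ s₀) : Set ι)) x)
  swap
  · -- not an island: both sides vanish
    have c1 : ¬ ((∀ z ∈ Z, z ∉ openCluster (ends '' (↑(s₀ ∪ s₁) : Set ι)) x ∧ z ∉ openCluster (ends '' (↑(E \ (s₀ ∪ s₁)) : Set ι)) x) ∧
        (∀ t ∈ Y, t ≠ x → (∃ i ∈ E, ∃ t', ends i = s(t, t') ∧ t' ∉ Y) →
          t ∈ openCluster (ends '' (↑(s₀) : Set ι)) x ∧ t ∈ openCluster (ends '' (↑(E.filter (fun i => ∀ y ∈ ends i, y ∈ Y) \ s₀)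
                : Set ι)) x)) := fun h => hP h.2
    have c2 : ¬ ((∀ t ∈ Y, t ≠ x → (∃ i ∈ E, ∃ t', ends i = s(t, t') ∧ t' ∉ Y) →
          t ∈ openCluster (ends '' (↑(s₀) : Set ι)) x ∧ t ∈ openCluster (ends '' (↑(E.filter (fun i => ∀ y ∈ ends i, y ∈ Y) \ s₀) : Set ι)) x) ∧
        (∀ z ∈ Z, z ∈ Y → z ∉ openCluster (ends '' (↑(s₀) : Set ι)) x ∧ z ∉ openCluster
              (ends '' (↑(E.filter (fun i => ∀ y ∈ ends i, y ∈ Y) \ s₀) : Set ι)) x)) := fun h => hP h.1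
    rw [if_neg c1, if_neg c2, zero_mul]
  -- island: clusters outside `Y` are those of the quotient, inside those of `G[Y]`
  have hredI : ∀ t ∈ Y, t ≠ x → (∃ i ∈ E, ∃ t', ends i = s(t, t') ∧ t' ∉ Y) →
      t ∈ openCluster (ends '' (↑((s₀ ∪ s₁).filter (fun i => ∀ y ∈ ends i, y ∈ Y)) : Set ι)) x := by
    intro t ht htx hbd; rw [e1]; exact (hP t ht htx hbd).1
  have hblueI : ∀ t ∈ Y, t ≠ x → (∃ i ∈ E, ∃ t', ends i = s(t, t') ∧ t' ∉ Y) →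
      t ∈ openCluster (ends '' (↑((E \ (s₀ ∪ s₁)).filter (fun i => ∀ y ∈ ends i, y ∈ Y)) : Set ι)) x := by
    intro t ht htx hbd; rw [e3]; exact (hP t ht htx hbd).2
  have outR : ∀ v, v ∉ Y → (v ∈ openCluster (ends '' (↑(s₀ ∪ s₁) : Set ι)) x ↔ v ∈ openCluster
        (ends '' (↑(s₁ ∪ E.filter (fun i => ∀ y ∈ ends i, y ∈ Y)) : Set ι)) x) := by
    intro v hv
    have h := mem_openCluster_iff_union_of_island ends E (s₀ ∪ s₁) hcE x Y hxY hredI hv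
    rw [e4] at h
    exact h
  have outB : ∀ v, v ∉ Y → (v ∈ openCluster (ends '' (↑(E \ (s₀ ∪ s₁)) : Set ι)) x ↔ v ∈ openCluster
        (ends '' (↑(((E \ E.filter (fun i => ∀ y ∈ ends i, y ∈ Y)) \ s₁) ∪ E.filter (fun i => ∀ y ∈ ends i, y ∈ Y)) : Set ι)) x) := by
    intro v hv
    have h := mem_openCluster_iff_union_of_island ends E (E \ (s₀ ∪ s₁)) Finset.sdiff_subset x Y hxY hblueI hv
    rw [e5] at h
    exact h
  have inR : ∀ v, v ∈ Y → (v ∈ openCluster (ends '' (↑(s₀ ∪ s₁) : Set ι)) x ↔ v ∈ openCluster (ends '' (↑(s₀) : Set ι)) x) := by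
    intro v hv
    have h := mem_openCluster_iff_inter_of_island ends E (s₀ ∪ s₁) hcE x Y hxY hredI hv
    rw [e1] at h
    exact h
  have inB : ∀ v, v ∈ Y → (v ∈ openCluster (ends '' (↑(E \ (s₀ ∪ s₁)) : Set ι)) x ↔ v ∈ openCluster
        (ends '' (↑(E.filter (fun i => ∀ y ∈ ends i, y ∈ Y) \ s₀) : Set ι)) x) := by
    intro v hv
    have h := mem_openCluster_iff_inter_of_island ends E (E \ (s₀ ∪ s₁)) Finset.sdiff_subset x Y hxY hblueI hv
    rw [e3] at h
    exact h
  -- the signs are read on the quotient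
  have hsig : ((if u ∈ openCluster (ends '' (↑(s₀ ∪ s₁) : Set ι)) x then (1 : ℝ) else 0) - (if u ∈ openCluster (ends '' (↑(E \ (s₀ ∪ s₁))
        : Set ι)) x then (1 : ℝ) else 0)) *
        ((if w ∈ openCluster (ends '' (↑(s₀ ∪ s₁) : Set ι)) x then (1 : ℝ) else 0) - (if w ∈ openCluster (ends '' (↑(E \ (s₀ ∪ s₁)) : Set ι)) x
              then (1 : ℝ) else 0))
      = ((if u ∈ openCluster (ends '' (↑(s₁ ∪ E.filter (fun i => ∀ y ∈ ends i, y ∈ Y)) : Set ι)) x then (1 : ℝ) else 0) - (if u ∈ openCluster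
            (ends '' (↑(((E \ E.filter (fun i => ∀ y ∈ ends i, y ∈ Y)) \ s₁) ∪ E.filter (fun i => ∀ y ∈ ends i, y ∈ Y)) : Set ι)) x then (1 : ℝ)
            else 0)) *
        ((if w ∈ openCluster (ends '' (↑(s₁ ∪ E.filter (fun i => ∀ y ∈ ends i, y ∈ Y)) : Set ι)) x then (1 : ℝ) else 0) - (if w ∈ openCluster
              (ends '' (↑(((E \ E.filter (fun i => ∀ y ∈ ends i, y ∈ Y)) \ s₁) ∪ E.filter (fun i => ∀ y ∈ ends i, y ∈ Y)) : Set ι)) x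
              then (1 : ℝ) else 0)) := by
    have h1 : (u ∈ openCluster (ends '' (↑(s₀ ∪ s₁) : Set ι)) x) = (u ∈ openCluster
          (ends '' (↑(s₁ ∪ E.filter (fun i => ∀ y ∈ ends i, y ∈ Y)) : Set ι)) x) := propext (outR u huY)
    have h2 : (u ∈ openCluster (ends '' (↑(E \ (s₀ ∪ s₁)) : Set ι)) x) = (u ∈ openCluster
          (ends '' (↑(((E \ E.filter (fun i => ∀ y ∈ ends i, y ∈ Y)) \ s₁) ∪ E.filter (fun i => ∀ y ∈ ends i, y ∈ Y))
          : Set ι)) x) := propext (outB u huY)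
    have h3 : (w ∈ openCluster (ends '' (↑(s₀ ∪ s₁) : Set ι)) x) = (w ∈ openCluster
          (ends '' (↑(s₁ ∪ E.filter (fun i => ∀ y ∈ ends i, y ∈ Y)) : Set ι)) x) := propext (outR w hwY)
    have h4 : (w ∈ openCluster (ends '' (↑(E \ (s₀ ∪ s₁)) : Set ι)) x) = (w ∈ openCluster
          (ends '' (↑(((E \ E.filter (fun i => ∀ y ∈ ends i, y ∈ Y)) \ s₁) ∪ E.filter (fun i => ∀ y ∈ ends i, y ∈ Y))
          : Set ι)) x) := propext (outB w hwY)
    simp only [h1, h2, h3, h4]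
  -- the wall splits
  have hwall : (∀ z ∈ Z, z ∉ openCluster (ends '' (↑(s₀ ∪ s₁) : Set ι)) x ∧ z ∉ openCluster (ends '' (↑(E \ (s₀ ∪ s₁)) : Set ι)) x) ↔
      ((∀ z ∈ Z, z ∈ Y → z ∉ openCluster (ends '' (↑(s₀) : Set ι)) x ∧ z ∉ openCluster
            (ends '' (↑(E.filter (fun i => ∀ y ∈ ends i, y ∈ Y) \ s₀) : Set ι)) x) ∧
       (∀ z ∈ Z, z ∉ Y → z ∉ openCluster (ends '' (↑(s₁ ∪ E.filter (fun i => ∀ y ∈ ends i, y ∈ Y)) : Set ι)) x ∧ z ∉ openCluster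
             (ends '' (↑(((E \ E.filter (fun i => ∀ y ∈ ends i, y ∈ Y)) \ s₁) ∪ E.filter (fun i => ∀ y ∈ ends i, y ∈ Y)) : Set ι)) x)) := by
    constructor
    · intro h
      refine ⟨fun z hz hzY => ?_, fun z hz hzY => ?_⟩
      · exact ⟨fun h' => (h z hz).1 ((inR z hzY).mpr h'), fun h' => (h z hz).2 ((inB z hzY).mpr h')⟩
      · exact ⟨fun h' => (h z hz).1 ((outR z hzY).mpr h'), fun h' => (h z hz).2 ((outB z hzY).mpr h')⟩
    · rintro ⟨hin, hout⟩ z hz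
      by_cases hzY : z ∈ Y
      · exact ⟨fun h' => (hin z hz hzY).1 ((inR z hzY).mp h'), fun h' => (hin z hz hzY).2 ((inB z hzY).mp h')⟩
      · exact ⟨fun h' => (hout z hz hzY).1 ((outR z hzY).mp h'), fun h' => (hout z hz hzY).2 ((outB z hzY).mp h')⟩
  rw [hsig]
  by_cases hWin : (∀ z ∈ Z, z ∈ Y → z ∉ openCluster (ends '' (↑(s₀) : Set ι)) x ∧ z ∉ openCluster
        (ends '' (↑(E.filter (fun i => ∀ y ∈ ends i, y ∈ Y) \ s₀) : Set ι)) x)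
  · by_cases hWout : (∀ z ∈ Z, z ∉ Y → z ∉ openCluster (ends '' (↑(s₁ ∪ E.filter (fun i => ∀ y ∈ ends i, y ∈ Y)) : Set ι)) x ∧ z ∉ openCluster
        (ends '' (↑(((E \ E.filter (fun i => ∀ y ∈ ends i, y ∈ Y)) \ s₁) ∪ E.filter (fun i => ∀ y ∈ ends i, y ∈ Y)) : Set ι)) x)
    · have c1 : (∀ z ∈ Z, z ∉ openCluster (ends '' (↑(s₀ ∪ s₁) : Set ι)) x ∧ z ∉ openCluster (ends '' (↑(E \ (s₀ ∪ s₁)) : Set ι)) x) ∧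
          (∀ t ∈ Y, t ≠ x → (∃ i ∈ E, ∃ t', ends i = s(t, t') ∧ t' ∉ Y) →
          t ∈ openCluster (ends '' (↑(s₀) : Set ι)) x ∧ t ∈ openCluster (ends '' (↑(E.filter (fun i => ∀ y ∈ ends i, y ∈ Y) \ s₀)
                : Set ι)) x) := ⟨hwall.mpr ⟨hWin, hWout⟩, hP⟩
      have c2 : (∀ t ∈ Y, t ≠ x → (∃ i ∈ E, ∃ t', ends i = s(t, t') ∧ t' ∉ Y) →
          t ∈ openCluster (ends '' (↑(s₀) : Set ι)) x ∧ t ∈ openCluster (ends '' (↑(E.filter (fun i => ∀ y ∈ ends i, y ∈ Y) \ s₀) : Set ι)) x) ∧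
          (∀ z ∈ Z, z ∈ Y → z ∉ openCluster (ends '' (↑(s₀) : Set ι)) x ∧ z ∉ openCluster
                (ends '' (↑(E.filter (fun i => ∀ y ∈ ends i, y ∈ Y) \ s₀) : Set ι)) x) := ⟨hP, hWin⟩
      rw [if_pos c1, if_pos c2, if_pos hWout, one_mul]
    · have c1 : ¬ ((∀ z ∈ Z, z ∉ openCluster (ends '' (↑(s₀ ∪ s₁) : Set ι)) x ∧ z ∉ openCluster (ends '' (↑(E \ (s₀ ∪ s₁)) : Set ι)) x) ∧
          (∀ t ∈ Y, t ≠ x → (∃ i ∈ E, ∃ t', ends i = s(t, t') ∧ t' ∉ Y) →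
          t ∈ openCluster (ends '' (↑(s₀) : Set ι)) x ∧ t ∈ openCluster (ends '' (↑(E.filter (fun i => ∀ y ∈ ends i, y ∈ Y) \ s₀)
                : Set ι)) x)) := fun h => hWout (hwall.mp h.1).2
      rw [if_neg c1, if_neg hWout, mul_zero]
  · have c1 : ¬ ((∀ z ∈ Z, z ∉ openCluster (ends '' (↑(s₀ ∪ s₁) : Set ι)) x ∧ z ∉ openCluster (ends '' (↑(E \ (s₀ ∪ s₁)) : Set ι)) x) ∧
        (∀ t ∈ Y, t ≠ x → (∃ i ∈ E, ∃ t', ends i = s(t, t') ∧ t' ∉ Y) →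
          t ∈ openCluster (ends '' (↑(s₀) : Set ι)) x ∧ t ∈ openCluster (ends '' (↑(E.filter (fun i => ∀ y ∈ ends i, y ∈ Y) \ s₀)
                : Set ι)) x)) := fun h => hWin (hwall.mp h.1).1
    have c2 : ¬ ((∀ t ∈ Y, t ≠ x → (∃ i ∈ E, ∃ t', ends i = s(t, t') ∧ t' ∉ Y) →
          t ∈ openCluster (ends '' (↑(s₀) : Set ι)) x ∧ t ∈ openCluster (ends '' (↑(E.filter (fun i => ∀ y ∈ ends i, y ∈ Y) \ s₀) : Set ι)) x) ∧
        (∀ z ∈ Z, z ∈ Y → z ∉ openCluster (ends '' (↑(s₀) : Set ι)) x ∧ z ∉ openCluster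
              (ends '' (↑(E.filter (fun i => ∀ y ∈ ends i, y ∈ Y) \ s₀) : Set ι)) x)) := fun h => hWin h.2
    rw [if_neg c1, if_neg c2, zero_mul]

end Coefficientwise

end Summit.CriticalPhenomena.PercolationContinuityZ3.Theorems
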